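import Mathlib
import HarnessLib
import Summits.HubbardSuperconductivity.HubbardSuperconductivity.Theorems.WeakCouplingBCSKlLindhardEnclosureTipRecords
import Summits.HubbardSuperconductivity.HubbardSuperconductivity.Theorems.WeakCouplingBCSKlLindhardEnclosureBdryRecords
import Summits.HubbardSuperconductivity.HubbardSuperconductivity.Theorems.WeakCouplingBCSKlLindhardEnclosureBdryRecords2
import Summits.HubbardSuperconductivity.HubbardSuperconductivity.Theorems.WeakCouplingBCSKlLindhardEnclosureCellIntIterated

/-!
# KL-MARGIN-SCAN reader (22) «kernel-lindhard-enclosure» — TIP RULE, the two energies on a cell in real coordinates (seat p4 g25)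

The band and the shifted band at `pt x y`, their four partial derivatives, and — on a guarded oriented in-root cell whose four cosine
windows carry a certified direction (`cosDirZ = some _`) and checked sine hints — the enclosure of the SCALED partials `10⁴·D·∂` in the
kernel's `derivIV` boxes (`…TipRecords.derivIV_sound` + p1 g26's `cosDirZ_true/false_sound`, `le_abs_sin_of_sinLoOK`, `abs_sin_le_of_sinHiOK`,
`cell_cos*_mem`), the excursion bounds `|εᵢ − μ| ≤ distHiZ/D` on the CLOSED cell, and `F(pt x y) ≤ 1/(|ε_p − μ| + |ε_{p+q} − μ|)`:

* `Params.tip_band_pt`, `Params.tip_band_pt_shift`, `hasDerivAt_bandFun_fst/_snd`;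
* `Params.integrand_pt_le_inv`;
* `Params.tip_dx_e1_mem`, `tip_dy_e1_mem`, `tip_dx_e2_mem`, `tip_dy_e2_mem` (scaled partials in `X1, Y1, X2, Y2`);
* `Params.tip_e1_abs_le`, `tip_e2_abs_le` (`|εᵢ − μ| ≤ distHiZ/D`), `Params.tip_partial_abs_le_Lmax`.

No integrals here.  Nothing asserts `CeilTipSoundOrd`, a χ₀ enclosure, a margin, `K₃`, `U₀`, the window or superconductivity.
References: idea-4 r11 Core §3b (tree: `…LindhardEnclosureKernel`).
-/

noncomputable section

set_option linter.dupNamespace false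

namespace Summit.HubbardSuperconductivity.HubbardSuperconductivity.Theorems.KlLindhardEnclosure

open Real Set MeasureTheory Literature.MathematicalPhysics.QuantumLattice

/-! ## §1 The two energies at `pt x y` and their partial derivatives -/

/-- The band function written out: `bandFun t x y = −2(cos x + cos y) − 4t cos x cos y`. (A local abbreviation-free spelling is used in every statement;
this lemma is the bridge from `P.band (pt x y)`.) [folklore] -/
theorem Params.tip_band_pt (P : Params) (x y : ℝ) :
    P.band (pt x y) = -2 * (Real.cos x + Real.cos y) - 4 * ((P.tpN : ℝ) / (P.tpD : ℝ)) * Real.cos x * Real.cos y := by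
  rw [P.band_apply, pt_apply_zero, pt_apply_one]

/-- The shifted point: `(pt x y + q)₀ = x + q₁/U`, `(pt x y + q)₁ = y + q₂/U`. [folklore] -/
theorem Params.pt_add_qv (P : Params) (x y : ℝ) :
    (pt x y + P.qv) 0 = x + (P.q1z : ℝ) / (P.U : ℝ) ∧ (pt x y + P.qv) 1 = y + (P.q2z : ℝ) / (P.U : ℝ) := by
  constructor
  · rw [PiLp.add_apply, P.qv_apply_zero, pt_apply_zero]
  · rw [PiLp.add_apply, P.qv_apply_one, pt_apply_one]

/-- The shifted band written out. [folklore] -/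
theorem Params.tip_band_pt_shift (P : Params) (x y : ℝ) :
    P.band (pt x y + P.qv) = -2 * (Real.cos (x + (P.q1z : ℝ) / (P.U : ℝ)) + Real.cos (y + (P.q2z : ℝ) / (P.U : ℝ))) -
      4 * ((P.tpN : ℝ) / (P.tpD : ℝ)) * Real.cos (x + (P.q1z : ℝ) / (P.U : ℝ)) * Real.cos (y + (P.q2z : ℝ) / (P.U : ℝ)) := by
  rw [P.band_apply, (P.pt_add_qv x y).1, (P.pt_add_qv x y).2]

/-- Partial derivative in the FIRST variable of `x ↦ −2(cos(x+s₁) + cos(y+s₂)) − 4t cos(x+s₁) cos(y+s₂) − μ`: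
`2 sin(x+s₁)(1 + 2t cos(y+s₂))`. [folklore] -/
theorem hasDerivAt_bandFun_fst (t μ s₁ s₂ y x : ℝ) :
    HasDerivAt (fun x' => -2 * (Real.cos (x' + s₁) + Real.cos (y + s₂)) - 4 * t * Real.cos (x' + s₁) * Real.cos (y + s₂) - μ)
      (2 * Real.sin (x + s₁) * (1 + 2 * t * Real.cos (y + s₂))) x := by
  have hfun : (fun x' => -2 * (Real.cos (x' + s₁) + Real.cos (y + s₂)) - 4 * t * Real.cos (x' + s₁) * Real.cos (y + s₂) - μ)
      = fun x' => (-2 - 4 * t * Real.cos (y + s₂)) * Real.cos (x' + s₁) + (-2 * Real.cos (y + s₂) - μ) := by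
    funext x'; ring
  rw [hfun]
  have h2 : HasDerivAt (fun x' : ℝ => Real.cos (x' + s₁)) (-Real.sin (x + s₁) * 1) x := ((hasDerivAt_id x).add_const s₁).cos
  have h3 := (h2.const_mul (-2 - 4 * t * Real.cos (y + s₂))).add_const (-2 * Real.cos (y + s₂) - μ)
  exact h3.congr_deriv (by ring)

/-- Partial derivative in the SECOND variable: `2 sin(y+s₂)(1 + 2t cos(x+s₁))`. [folklore] -/
theorem hasDerivAt_bandFun_snd (t μ s₁ s₂ x y : ℝ) :
    HasDerivAt (fun y' => -2 * (Real.cos (x + s₁) + Real.cos (y' + s₂)) - 4 * t * Real.cos (x + s₁) * Real.cos (y' + s₂) - μ)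
      (2 * Real.sin (y + s₂) * (1 + 2 * t * Real.cos (x + s₁))) y := by
  have hfun : (fun y' => -2 * (Real.cos (x + s₁) + Real.cos (y' + s₂)) - 4 * t * Real.cos (x + s₁) * Real.cos (y' + s₂) - μ)
      = fun y' => (-2 - 4 * t * Real.cos (x + s₁)) * Real.cos (y' + s₂) + (-2 * Real.cos (x + s₁) - μ) := by
    funext y'; ring
  rw [hfun]
  have h2 : HasDerivAt (fun y' : ℝ => Real.cos (y' + s₂)) (-Real.sin (y + s₂) * 1) y := ((hasDerivAt_id y).add_const s₂).cos
  have h3 := (h2.const_mul (-2 - 4 * t * Real.cos (x + s₁))).add_const (-2 * Real.cos (x + s₁) - μ)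
  exact h3.congr_deriv (by ring)

/-- **The integrand at `pt x y` is at most `1/(|ε_p − μ| + |ε_{p+q} − μ|)`** (Literature `lindhardIntegrand_le_inv`). [folklore] -/
theorem Params.integrand_pt_le_inv (P : Params) (x y : ℝ) :
    P.integrand (pt x y) ≤ 1 / (|P.band (pt x y) - (P.muN : ℝ) / (P.muD : ℝ)| + |P.band (pt x y + P.qv) - (P.muN : ℝ) / (P.muD : ℝ)|) := by
  show lindhardIntegrand P.band ((P.mu : ℚ) : ℝ) P.qv (pt x y) ≤ _
  rw [P.cast_mu]
  exact lindhardIntegrand_le_inv _ _ _ _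

/-! ## §2 The scaled partials in the kernel's `derivIV` boxes -/

section Cell

variable (P : Params) {a b c d : ℤ}

/-- Window arithmetic: `a/U ≤ x ≤ b/U ⇒ (a + s)/U ≤ x + s/U ≤ (b + s)/U`. [folklore] -/
theorem Params.shift_window (s : ℤ) {x : ℝ} (hx0 : (a : ℝ) / (P.U : ℝ) ≤ x) (hx1 : x ≤ (b : ℝ) / (P.U : ℝ)) :
    ((a + s : ℤ) : ℝ) / (P.U : ℝ) ≤ x + (s : ℝ) / (P.U : ℝ) ∧ x + (s : ℝ) / (P.U : ℝ) ≤ ((b + s : ℤ) : ℝ) / (P.U : ℝ) := by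
  push_cast
  rw [add_div, add_div]
  exact ⟨by linarith, by linarith⟩

/-- The sign of `sin r` from a certified direction: `some true ⇒ 0 ≤ sin r`, `some false ⇒ sin r ≤ 0` on the window. [folklore] -/
theorem Params.sin_sign_of_cosDirZ (hP : P.admissible = true) {u0 u1 : ℤ} {dir : Bool} (h : P.cosDirZ u0 u1 = some dir) {r : ℝ}
    (hr0 : (u0 : ℝ) / (P.U : ℝ) ≤ r) (hr1 : r ≤ (u1 : ℝ) / (P.U : ℝ)) :
    (dir = true → 0 ≤ Real.sin r) ∧ (dir = false → Real.sin r ≤ 0) := by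
  constructor
  · intro hd; subst hd
    exact (P.cosDirZ_true_sound hP h hr0 le_rfl hr1).1
  · intro hd; subst hd
    exact (P.cosDirZ_false_sound hP h hr0 le_rfl hr1).1

/-- **`∂ₓ(ε_p − μ)` scaled**: on the closed cell, `X1.lo ≤ 10⁴·D·(2 sin x (1 + 2t′cos y)) ≤ X1.hi`, `X1 = derivIV dx τx σx bLo bUp`. [folklore] -/
theorem Params.tip_dx_e1_mem (hP : P.admissible = true) (hin : P.InRoot a b c d) {dx : Bool} {τx σx : ℕ}
    (hdx : P.cosDirZ a b = some dx)
    (hτ : sinLoOK (P.cell (P.mkX a) (P.mkX b) (P.mkY c) (P.mkY d)).aLo (P.cell (P.mkX a) (P.mkX b) (P.mkY c) (P.mkY d)).aUp τx = true)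
    (hσ : sinHiOK (P.cell (P.mkX a) (P.mkX b) (P.mkY c) (P.mkY d)).aLo (P.cell (P.mkX a) (P.mkX b) (P.mkY c) (P.mkY d)).aUp σx = true)
    (hg : (P.cell (P.mkX a) (P.mkX b) (P.mkY c) (P.mkY d)).guards = true)
    {x y : ℝ} (hx0 : (a : ℝ) / (P.U : ℝ) ≤ x) (hx1 : x ≤ (b : ℝ) / (P.U : ℝ)) (hy0 : (c : ℝ) / (P.U : ℝ) ≤ y) (hy1 : y ≤ (d : ℝ) / (P.U : ℝ)) :
    (((P.derivIV dx τx σx (P.cell (P.mkX a) (P.mkX b) (P.mkY c) (P.mkY d)).bLo (P.cell (P.mkX a) (P.mkX b) (P.mkY c) (P.mkY d)).bUp).lo : ℤ) : ℝ) ≤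
        10 ^ 4 * 2 ^ 40 * (2 * Real.sin x * (1 + 2 * ((P.tpN : ℝ) / (P.tpD : ℝ)) * Real.cos y)) ∧
      10 ^ 4 * 2 ^ 40 * (2 * Real.sin x * (1 + 2 * ((P.tpN : ℝ) / (P.tpD : ℝ)) * Real.cos y)) ≤
        (((P.derivIV dx τx σx (P.cell (P.mkX a) (P.mkX b) (P.mkY c) (P.mkY d)).bLo (P.cell (P.mkX a) (P.mkX b) (P.mkY c) (P.mkY d)).bUp).hi : ℤ) : ℝ) := by
  obtain ⟨htpD, -, -, -, -⟩ := P.admissible_facts hP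
  obtain ⟨ha, -, -, hb, hc, -, -, hd⟩ := hin
  obtain ⟨cx1, cx2⟩ := P.cell_cosx_mem hP (c := c) (d := d) ha hb hx0 hx1
  obtain ⟨cy1, cy2⟩ := P.cell_cosy_mem hP (a := a) (b := b) hc hd hy0 hy1
  obtain ⟨-, -, g3, g4, -, -, -, -⟩ := P.cell_guards _ _ _ _ hg
  have hop := P.two_add_pos_on htpD g3 g4 cy1 cy2
  obtain ⟨sT, sF⟩ := P.sin_sign_of_cosDirZ hP hdx hx0 hx1
  exact P.derivIV_sound htpD sT sF (le_abs_sin_of_sinLoOK hτ cx1 cx2) (abs_sin_le_of_sinHiOK hσ cx1 cx2) cy1 cy2 (by linarith)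

/-- **`∂_y(ε_p − μ)` scaled**: `Y1.lo ≤ 10⁴·D·(2 sin y (1 + 2t′cos x)) ≤ Y1.hi`, `Y1 = derivIV dy τy σy aLo aUp`. [folklore] -/
theorem Params.tip_dy_e1_mem (hP : P.admissible = true) (hin : P.InRoot a b c d) {dy : Bool} {τy σy : ℕ}
    (hdy : P.cosDirZ c d = some dy)
    (hτ : sinLoOK (P.cell (P.mkX a) (P.mkX b) (P.mkY c) (P.mkY d)).bLo (P.cell (P.mkX a) (P.mkX b) (P.mkY c) (P.mkY d)).bUp τy = true)
    (hσ : sinHiOK (P.cell (P.mkX a) (P.mkX b) (P.mkY c) (P.mkY d)).bLo (P.cell (P.mkX a) (P.mkX b) (P.mkY c) (P.mkY d)).bUp σy = true)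
    (hg : (P.cell (P.mkX a) (P.mkX b) (P.mkY c) (P.mkY d)).guards = true)
    {x y : ℝ} (hx0 : (a : ℝ) / (P.U : ℝ) ≤ x) (hx1 : x ≤ (b : ℝ) / (P.U : ℝ)) (hy0 : (c : ℝ) / (P.U : ℝ) ≤ y) (hy1 : y ≤ (d : ℝ) / (P.U : ℝ)) :
    (((P.derivIV dy τy σy (P.cell (P.mkX a) (P.mkX b) (P.mkY c) (P.mkY d)).aLo (P.cell (P.mkX a) (P.mkX b) (P.mkY c) (P.mkY d)).aUp).lo : ℤ) : ℝ) ≤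
        10 ^ 4 * 2 ^ 40 * (2 * Real.sin y * (1 + 2 * ((P.tpN : ℝ) / (P.tpD : ℝ)) * Real.cos x)) ∧
      10 ^ 4 * 2 ^ 40 * (2 * Real.sin y * (1 + 2 * ((P.tpN : ℝ) / (P.tpD : ℝ)) * Real.cos x)) ≤
        (((P.derivIV dy τy σy (P.cell (P.mkX a) (P.mkX b) (P.mkY c) (P.mkY d)).aLo (P.cell (P.mkX a) (P.mkX b) (P.mkY c) (P.mkY d)).aUp).hi : ℤ) : ℝ) := by
  obtain ⟨htpD, -, -, -, -⟩ := P.admissible_facts hP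
  obtain ⟨ha, -, -, hb, hc, -, -, hd⟩ := hin
  obtain ⟨cx1, cx2⟩ := P.cell_cosx_mem hP (c := c) (d := d) ha hb hx0 hx1
  obtain ⟨cy1, cy2⟩ := P.cell_cosy_mem hP (a := a) (b := b) hc hd hy0 hy1
  obtain ⟨g1, g2, -, -, -, -, -, -⟩ := P.cell_guards _ _ _ _ hg
  have hop := P.two_add_pos_on htpD g1 g2 cx1 cx2
  obtain ⟨sT, sF⟩ := P.sin_sign_of_cosDirZ hP hdy hy0 hy1
  exact P.derivIV_sound htpD sT sF (le_abs_sin_of_sinLoOK hτ cy1 cy2) (abs_sin_le_of_sinHiOK hσ cy1 cy2) cx1 cx2 (by linarith)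

/-- **`∂ₓ(ε_{p+q} − μ)` scaled**: `X2.lo ≤ 10⁴·D·(2 sin(x+q₁)(1 + 2t′cos(y+q₂))) ≤ X2.hi`, `X2 = derivIV dx′ τx′ σx′ bLo′ bUp′`. [folklore] -/
theorem Params.tip_dx_e2_mem (hP : P.admissible = true) (hin : P.InRoot a b c d) {dx' : Bool} {τx' σx' : ℕ}
    (hdx : P.cosDirZ (a + P.q1z) (b + P.q1z) = some dx')
    (hτ : sinLoOK (P.cell (P.mkX a) (P.mkX b) (P.mkY c) (P.mkY d)).aLo' (P.cell (P.mkX a) (P.mkX b) (P.mkY c) (P.mkY d)).aUp' τx' = true)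
    (hσ : sinHiOK (P.cell (P.mkX a) (P.mkX b) (P.mkY c) (P.mkY d)).aLo' (P.cell (P.mkX a) (P.mkX b) (P.mkY c) (P.mkY d)).aUp' σx' = true)
    (hg : (P.cell (P.mkX a) (P.mkX b) (P.mkY c) (P.mkY d)).guards = true)
    {x y : ℝ} (hx0 : (a : ℝ) / (P.U : ℝ) ≤ x) (hx1 : x ≤ (b : ℝ) / (P.U : ℝ)) (hy0 : (c : ℝ) / (P.U : ℝ) ≤ y) (hy1 : y ≤ (d : ℝ) / (P.U : ℝ)) :
    (((P.derivIV dx' τx' σx' (P.cell (P.mkX a) (P.mkX b) (P.mkY c) (P.mkY d)).bLo' (P.cell (P.mkX a) (P.mkX b) (P.mkY c) (P.mkY d)).bUp').lo : ℤ) : ℝ) ≤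
        10 ^ 4 * 2 ^ 40 * (2 * Real.sin (x + (P.q1z : ℝ) / (P.U : ℝ)) * (1 + 2 * ((P.tpN : ℝ) / (P.tpD : ℝ)) * Real.cos (y + (P.q2z : ℝ) / (P.U : ℝ)))) ∧
      10 ^ 4 * 2 ^ 40 * (2 * Real.sin (x + (P.q1z : ℝ) / (P.U : ℝ)) * (1 + 2 * ((P.tpN : ℝ) / (P.tpD : ℝ)) * Real.cos (y + (P.q2z : ℝ) / (P.U : ℝ)))) ≤
        (((P.derivIV dx' τx' σx' (P.cell (P.mkX a) (P.mkX b) (P.mkY c) (P.mkY d)).bLo' (P.cell (P.mkX a) (P.mkX b) (P.mkY c) (P.mkY d)).bUp').hi : ℤ) : ℝ) := by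
  obtain ⟨htpD, -, -, -, -⟩ := P.admissible_facts hP
  obtain ⟨ha, -, -, hb, hc, -, -, hd⟩ := hin
  obtain ⟨cx1, cx2⟩ := P.cell_cosx'_mem hP (c := c) (d := d) ha hb hx0 hx1
  obtain ⟨cy1, cy2⟩ := P.cell_cosy'_mem hP (a := a) (b := b) hc hd hy0 hy1
  obtain ⟨-, -, -, -, -, -, g7, g8⟩ := P.cell_guards _ _ _ _ hg
  have hop := P.two_add_pos_on htpD g7 g8 cy1 cy2
  obtain ⟨w0, w1⟩ := P.shift_window P.q1z hx0 hx1
  obtain ⟨sT, sF⟩ := P.sin_sign_of_cosDirZ hP hdx w0 w1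
  exact P.derivIV_sound htpD sT sF (le_abs_sin_of_sinLoOK hτ cx1 cx2) (abs_sin_le_of_sinHiOK hσ cx1 cx2) cy1 cy2 (by linarith)

/-- **`∂_y(ε_{p+q} − μ)` scaled**: `Y2.lo ≤ 10⁴·D·(2 sin(y+q₂)(1 + 2t′cos(x+q₁))) ≤ Y2.hi`, `Y2 = derivIV dy′ τy′ σy′ aLo′ aUp′`. [folklore] -/
theorem Params.tip_dy_e2_mem (hP : P.admissible = true) (hin : P.InRoot a b c d) {dy' : Bool} {τy' σy' : ℕ}
    (hdy : P.cosDirZ (c + P.q2z) (d + P.q2z) = some dy')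
    (hτ : sinLoOK (P.cell (P.mkX a) (P.mkX b) (P.mkY c) (P.mkY d)).bLo' (P.cell (P.mkX a) (P.mkX b) (P.mkY c) (P.mkY d)).bUp' τy' = true)
    (hσ : sinHiOK (P.cell (P.mkX a) (P.mkX b) (P.mkY c) (P.mkY d)).bLo' (P.cell (P.mkX a) (P.mkX b) (P.mkY c) (P.mkY d)).bUp' σy' = true)
    (hg : (P.cell (P.mkX a) (P.mkX b) (P.mkY c) (P.mkY d)).guards = true)
    {x y : ℝ} (hx0 : (a : ℝ) / (P.U : ℝ) ≤ x) (hx1 : x ≤ (b : ℝ) / (P.U : ℝ)) (hy0 : (c : ℝ) / (P.U : ℝ) ≤ y) (hy1 : y ≤ (d : ℝ) / (P.U : ℝ)) :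
    (((P.derivIV dy' τy' σy' (P.cell (P.mkX a) (P.mkX b) (P.mkY c) (P.mkY d)).aLo' (P.cell (P.mkX a) (P.mkX b) (P.mkY c) (P.mkY d)).aUp').lo : ℤ) : ℝ) ≤
        10 ^ 4 * 2 ^ 40 * (2 * Real.sin (y + (P.q2z : ℝ) / (P.U : ℝ)) * (1 + 2 * ((P.tpN : ℝ) / (P.tpD : ℝ)) * Real.cos (x + (P.q1z : ℝ) / (P.U : ℝ)))) ∧
      10 ^ 4 * 2 ^ 40 * (2 * Real.sin (y + (P.q2z : ℝ) / (P.U : ℝ)) * (1 + 2 * ((P.tpN : ℝ) / (P.tpD : ℝ)) * Real.cos (x + (P.q1z : ℝ) / (P.U : ℝ)))) ≤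
        (((P.derivIV dy' τy' σy' (P.cell (P.mkX a) (P.mkX b) (P.mkY c) (P.mkY d)).aLo' (P.cell (P.mkX a) (P.mkX b) (P.mkY c) (P.mkY d)).aUp').hi : ℤ) : ℝ) := by
  obtain ⟨htpD, -, -, -, -⟩ := P.admissible_facts hP
  obtain ⟨ha, -, -, hb, hc, -, -, hd⟩ := hin
  obtain ⟨cx1, cx2⟩ := P.cell_cosx'_mem hP (c := c) (d := d) ha hb hx0 hx1
  obtain ⟨cy1, cy2⟩ := P.cell_cosy'_mem hP (a := a) (b := b) hc hd hy0 hy1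
  obtain ⟨-, -, -, -, g5, g6, -, -⟩ := P.cell_guards _ _ _ _ hg
  have hop := P.two_add_pos_on htpD g5 g6 cx1 cx2
  obtain ⟨w0, w1⟩ := P.shift_window P.q2z hy0 hy1
  obtain ⟨sT, sF⟩ := P.sin_sign_of_cosDirZ hP hdy w0 w1
  exact P.derivIV_sound htpD sT sF (le_abs_sin_of_sinLoOK hτ cy1 cy2) (abs_sin_le_of_sinHiOK hσ cy1 cy2) cx1 cx2 (by linarith)

/-! ## §3 Excursions and the uniform partial bound on the closed cell -/

/-- **`|ε_p − μ| ≤ distHiZ e1Lo e1Hi / D`** on the CLOSED cell. [folklore] -/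
theorem Params.tip_e1_abs_le (hP : P.admissible = true) (hin : P.InRoot a b c d)
    (hg : (P.cell (P.mkX a) (P.mkX b) (P.mkY c) (P.mkY d)).guards = true)
    {x y : ℝ} (hx0 : (a : ℝ) / (P.U : ℝ) ≤ x) (hx1 : x ≤ (b : ℝ) / (P.U : ℝ)) (hy0 : (c : ℝ) / (P.U : ℝ) ≤ y) (hy1 : y ≤ (d : ℝ) / (P.U : ℝ)) :
    |P.band (pt x y) - (P.muN : ℝ) / (P.muD : ℝ)| ≤
      ((P.distHiZ (P.cell (P.mkX a) (P.mkX b) (P.mkY c) (P.mkY d)).e1Lo (P.cell (P.mkX a) (P.mkX b) (P.mkY c) (P.mkY d)).e1Hi : ℤ) : ℝ) / 2 ^ 40 := by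
  obtain ⟨htpD, hmuD, -, -, -⟩ := P.admissible_facts hP
  obtain ⟨ha, -, -, hb, hc, -, -, hd⟩ := hin
  obtain ⟨cx1, cx2⟩ := P.cell_cosx_mem hP (c := c) (d := d) ha hb hx0 hx1
  obtain ⟨cy1, cy2⟩ := P.cell_cosy_mem hP (a := a) (b := b) hc hd hy0 hy1
  obtain ⟨g1, g2, g3, g4, -, -, -, -⟩ := P.cell_guards _ _ _ _ hg
  obtain ⟨e1, e2⟩ := P.band_enclosure htpD g1 g2 g3 g4 cx1 cx2 cy1 cy2
  rw [P.tip_band_pt]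
  exact P.abs_sub_mu_le_distHiZ hmuD (by simpa [Params.cell] using e1) (by simpa [Params.cell] using e2)

/-- **`|ε_{p+q} − μ| ≤ distHiZ e2Lo e2Hi / D`** on the CLOSED cell. [folklore] -/
theorem Params.tip_e2_abs_le (hP : P.admissible = true) (hin : P.InRoot a b c d)
    (hg : (P.cell (P.mkX a) (P.mkX b) (P.mkY c) (P.mkY d)).guards = true)
    {x y : ℝ} (hx0 : (a : ℝ) / (P.U : ℝ) ≤ x) (hx1 : x ≤ (b : ℝ) / (P.U : ℝ)) (hy0 : (c : ℝ) / (P.U : ℝ) ≤ y) (hy1 : y ≤ (d : ℝ) / (P.U : ℝ)) :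
    |P.band (pt x y + P.qv) - (P.muN : ℝ) / (P.muD : ℝ)| ≤
      ((P.distHiZ (P.cell (P.mkX a) (P.mkX b) (P.mkY c) (P.mkY d)).e2Lo (P.cell (P.mkX a) (P.mkX b) (P.mkY c) (P.mkY d)).e2Hi : ℤ) : ℝ) / 2 ^ 40 := by
  obtain ⟨htpD, hmuD, -, -, -⟩ := P.admissible_facts hP
  obtain ⟨ha, -, -, hb, hc, -, -, hd⟩ := hin
  obtain ⟨cx1, cx2⟩ := P.cell_cosx'_mem hP (c := c) (d := d) ha hb hx0 hx1
  obtain ⟨cy1, cy2⟩ := P.cell_cosy'_mem hP (a := a) (b := b) hc hd hy0 hy1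
  obtain ⟨-, -, -, -, g5, g6, g7, g8⟩ := P.cell_guards _ _ _ _ hg
  obtain ⟨e1, e2⟩ := P.band_enclosure htpD g5 g6 g7 g8 cx1 cx2 cy1 cy2
  rw [P.tip_band_pt_shift]
  exact P.abs_sub_mu_le_distHiZ hmuD (by simpa [Params.cell] using e1) (by simpa [Params.cell] using e2)

/-- **Uniform bound on the four scaled partials**: each `10⁴·D·|∂| ≤ Lmax = 2·10⁴·(D + ⌈2|tpN|D/tpD⌉)`. [folklore] -/
theorem Params.tip_partial_abs_le_Lmax (hP : P.admissible = true) (r s : ℝ) :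
    (10 : ℝ) ^ 4 * 2 ^ 40 * |2 * Real.sin r * (1 + 2 * ((P.tpN : ℝ) / (P.tpD : ℝ)) * Real.cos s)| ≤
      ((2 * 10 ^ 4 * (D + cdivZ (2 * |P.tpN| * D) P.tpD) : ℤ) : ℝ) :=
  P.scaled_partial_le_Lmax (P.admissible_facts hP).1 r s

end Cell

end Summit.HubbardSuperconductivity.HubbardSuperconductivity.Theorems.KlLindhardEnclosure

end
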